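import Literature.NumberTheory.EllipticCurves.CanonicalPAdicHeight
import HarnessLib

/-!
# The canonical cyclotomic `p`-adic height datum `cyclotomicPAdicHeight W p` (and `…K W p K`)

Trunk T-ELLARITH (Literature/NumberTheory/EllipticCurves); definition request
`defn-cyclotomicPAdicHeight` (route BirchSwinnertonDyer/PAdicOrder, crux #4 stmt-0138 "Schneider's
conjecture for THE canonical height"; facts wi-03669 (Perrin-Riou 1992 / Schneider 1985: leading term
of `char_Λ X` and `Reg_p`), wi-03670 (`p`-adic Gross–Zagier, height over `K` of the Heegner point)).

## What is defined

The tree already has (all in `CanonicalPAdicHeight.lean`):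

* the hypothesis structures `PAdicHeightData W p` / `PAdicHeightDataK W p K` (a symmetric bilinear
  torsion-vanishing pairing `E(ℚ) →+ E(ℚ) →+ ℚ_p`, resp. on `E(K)`), inhabited by the zero pairing;
* the canonicity predicates `PAdicHeightData.IsCanonical D` / `PAdicHeightDataK.IsCanonical DK`:
  on every admissible point `⟨P, P⟩ = ĥ_p(P) = 2 log_p(e(P)/σ_p(P))` — the Mazur–Tate sigma-function
  formula for the canonical cyclotomic `p`-adic height (Schneider 1982 = Mazur–Tate 1983 =
  Nekovář; Mazur–Stein–Tate 2006, §1 eq. (1.1) `h_p(P) = p⁻¹ log_p(σ(P)/d(P))`, in the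
  Stein–Wuthrich 2013 §4.1 normalisation `ĥ_p = -2p·h_p` used by the tree's `PAdicBSDConjecture`);
* the PROVED uniqueness `PAdicHeightData.isCanonical_unique` (a bilinear symmetric torsion-vanishing
  pairing is determined by its quadratic form on a set meeting a non-zero multiple of every
  non-torsion point: MST 2006, §1 "the height function `h_p` extends uniquely to a function on the
  full Mordell–Weil group `E(ℚ)` that satisfies `h_p(nQ) = n² h_p(Q)`"), given admissible multiples;
* the named facts `exists_isCanonical` (existence for `W` globally minimal, `p ≥ 5` good ordinary),
  `exists_admissible_nsmul`, and their `K`-versions `exists_isCanonicalK`, `exists_admissibleK_nsmul`,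
  `isCanonicalK_restrictsTo`.

This file turns the predicate into a TERM, exactly as `PadicSigma.lean` does for `σ_p`
(`mazurTatePair := if h : ∃ σc, IsMazurTateSigmaPair σc then h.choose else junk`):

* `WeierstrassCurve.cyclotomicPAdicHeight W p : PAdicHeightData W p` — THE datum satisfying
  `IsCanonical` if there is one (global choice; it is then unique, `eq_cyclotomicPAdicHeight`), and
  the zero datum `PAdicHeightData.zero` as documented junk value otherwise;
* `WeierstrassCurve.cyclotomicPAdicHeightK W p K : PAdicHeightDataK W p K` — the same over a number
  field `K` (canonical only for `p` totally split in `K`, as built into `PAdicHeightDataK.IsCanonical`).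

So, for `W` globally minimal and `p ≥ 5` of good ordinary reduction (the hypotheses of the fact
`exists_isCanonical`), `cyclotomicPAdicHeight W p` IS the canonical cyclotomic `p`-adic height
pairing of `E/ℚ` in the Stein–Wuthrich normalisation, `SchneiderConjecture (cyclotomicPAdicHeight W p)`
is Schneider's conjecture proper (MST 2006, Conj. 1.1: "The cyclotomic height pairing `( , )_p` is
nondegenerate; equivalently, the `p`-adic regulator is nonzero"), and
`padicRegulator (cyclotomicPAdicHeight W p)` is the `p`-adic regulator `Reg_p(E/ℚ)`. Off that
regime (non-minimal model, `p ∣ a_p`, bad `p`, `p ≤ 3`) the sigma-function predicate is not the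
literature's definition and the term is unspecified (choice) or the junk zero datum: every consumer
must carry the hypotheses, as the facts in `CanonicalPAdicHeight.lean` do.

## API (all proved)

`isCanonical_cyclotomicPAdicHeight` (given `∃ D, D.IsCanonical`), `cyclotomicPAdicHeight_of_not_exists`
(junk branch), `eq_cyclotomicPAdicHeight` (any canonical datum is this one, given admissible
multiples), `cyclotomicPAdicHeight_pairing_self` (`⟨P,P⟩ = ĥ_p(P)` on admissible `P`), the
fact-fed versions `isCanonical_cyclotomicPAdicHeight_of_fact`, `eq_cyclotomicPAdicHeight_of_fact`,
and `schneiderConjecture_cyclotomicPAdicHeight_iff` (the term phrasing of stmt-0138 ⇔ the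
`∀ D, D.IsCanonical → SchneiderConjecture D` phrasing of stmt-0536); `K`-analogues.

## Sources

* B. Mazur, W. Stein, J. Tate, *Computation of `p`-adic heights and log convergence*, Doc. Math.
  Extra Vol. Coates (2006), §1: eq. (1.1), "extends uniquely", Conj. 1.1, Thm. 1.3.
* W. Stein, C. Wuthrich, *Algorithms for the arithmetic of elliptic curves using Iwasawa theory*,
  Math. Comp. 82 (2013), §4.1 eq. (4.1) (normalisation `ĥ_p`).
* P. Schneider, *`p`-adic height pairings I*, Invent. Math. 69 (1982), §1; *II*, Invent. Math. 79
  (1985).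
* B. Mazur, J. Tate, J. Teitelbaum, Invent. Math. 84 (1986), §II.4–II.5 (`p`-adic height,
  regulator, Schneider's conjecture).
* B. Perrin-Riou, Invent. Math. 89 (1987), §1.2 (height over `K`);
  J. Balakrishnan, M. Çiperiani, W. Stein, Math. Comp. 84 (2015), §4.1 eq. (4.1).
* J. Nekovář, *Selmer complexes*, Astérisque 310 (2006), §11 (equality of the constructions).

## Design notes

* Choice, not construction: an honest CONSTRUCTION of the pairing (extend `ĥ_p` from admissible
  points by `ĥ(P) := ĥ(mP)/m²` and polarise) would need, to produce the bundled `→+ →+`, the deep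
  theorem that `ĥ_p` is a quadratic form (Bernardi 1981 / Mazur–Tate 1991 / MST 2006 §1), which is
  exactly the content of the named fact `exists_isCanonical`. Defining the term by choice over
  `IsCanonical` and PROVING it is pinned down (`eq_cyclotomicPAdicHeight`) keeps Literature
  sorry-free and makes `(h : exists_isCanonical)`-fed statements about the term literal statements
  about the canonical height.
* No hypotheses in the TYPE (`[IsGloballyMinimal]`, ordinarity): as for `padicSigma`,
  `canonicalPAdicHeight`, `IsCanonical`; hypotheses live in the facts and lemmas.
* `PAdicHeightData.zero` is added here (its `K`-twin `PAdicHeightDataK.zero` exists in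
  `PAdicHeightsK.lean`); `PAdicHeights.lean` deliberately omitted the trivial `Nonempty` instance,
  and we still state no instance — `zero` is only the named junk value.
-/

noncomputable section

open scoped Classical

namespace WeierstrassCurve

variable (W : WeierstrassCurve ℚ) (p : ℕ) [Fact p.Prime]

/-! ### The zero datum over `ℚ` (junk value) -/

/-- The zero `p`-adic height datum on `E(ℚ)` (pairing identically `0`): the junk value of
`cyclotomicPAdicHeight` and the witness of the vacuity flag on `PAdicHeightData` (twin of
`PAdicHeightDataK.zero`). [folklore] -/
protected def PAdicHeightData.zero : PAdicHeightData W p where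
  pairing := 0
  symm := fun _ _ => rfl
  map_torsion := fun _ _ _ => rfl

/-- The zero datum pairs everything to `0`. [folklore] -/
@[simp] theorem PAdicHeightData.zero_pairing (P Q : W.toAffine.Point) :
    (PAdicHeightData.zero W p).pairing P Q = 0 := rfl

/-! ### The canonical cyclotomic `p`-adic height datum over `ℚ` -/

/-- **The canonical cyclotomic `p`-adic height pairing of `E/ℚ` at `p`**, as a term of the
hypothesis structure `PAdicHeightData W p`: by (global) choice, THE datum `D` with `D.IsCanonical`
— i.e. whose quadratic form on admissible points is the Mazur–Tate sigma-function formula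
`⟨P, P⟩ = ĥ_p(P) = 2 log_p(e(P)/σ_p(P))` (Stein–Wuthrich normalisation, `= -2p ·` the `h_p` of
Mazur–Stein–Tate 2006, eq. (1.1) `h_p(P) = p⁻¹ log_p(σ(P)/d(P))`) — if such a datum exists, and the
zero datum `PAdicHeightData.zero` (JUNK) otherwise. When it exists it is unique
(`eq_cyclotomicPAdicHeight`, from `PAdicHeightData.isCanonical_unique`: MST 2006 §1, "`h_p` extends
uniquely to … `E(ℚ)` … `h_p(nQ) = n² h_p(Q)`"), and existence for `W` globally minimal and `p ≥ 5`
of good ordinary reduction is the named fact `exists_isCanonical`; in that regime this is the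
canonical cyclotomic `p`-adic height of Schneider 1982 §1 = Mazur–Tate 1983 = Nekovář 2006 §11
(MTT 1986, §II.4), and `SchneiderConjecture (W.cyclotomicPAdicHeight p)` is MST 2006 Conj. 1.1.
Outside it (non-minimal `W`, `p ≤ 3`, bad or supersingular `p`) the value is unspecified/junk.
[Mazur–Stein–Tate 2006, §1 eq. (1.1) and Conj. 1.1; Stein–Wuthrich 2013, §4.1 eq. (4.1);
Mazur–Tate–Teitelbaum 1986, §II.4] [cite: MazurSteinTate2006, §1 eq. (1.1)] -/
def cyclotomicPAdicHeight : PAdicHeightData W p :=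
  if h : ∃ D : PAdicHeightData W p, D.IsCanonical then h.choose else PAdicHeightData.zero W p

variable {W p}

/-- If some canonical datum exists, `cyclotomicPAdicHeight W p` is canonical: on admissible points
`⟨P, P⟩ = ĥ_p(P)`. [Mazur–Stein–Tate 2006, §1 eq. (1.1)] [folklore] -/
theorem isCanonical_cyclotomicPAdicHeight (h : ∃ D : PAdicHeightData W p, D.IsCanonical) :
    (W.cyclotomicPAdicHeight p).IsCanonical := by
  unfold cyclotomicPAdicHeight
  rw [dif_pos h]
  exact h.choose_spec

/-- Junk branch: with no canonical datum, `cyclotomicPAdicHeight W p` is the zero datum.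
[folklore] -/
theorem cyclotomicPAdicHeight_of_not_exists (h : ¬ ∃ D : PAdicHeightData W p, D.IsCanonical) :
    W.cyclotomicPAdicHeight p = PAdicHeightData.zero W p := by
  unfold cyclotomicPAdicHeight
  rw [dif_neg h]

/-- On an admissible point the canonical datum computes the sigma-formula height,
`⟨P, P⟩ = ĥ_p(P) = log_p(den x(P)) - 2 log_p σ_p(-x/y)` (given existence).
[Stein–Wuthrich 2013, §4.1 eq. (4.1); Mazur–Stein–Tate 2006, §1 eq. (1.1)] [folklore] -/
theorem cyclotomicPAdicHeight_pairing_self (h : ∃ D : PAdicHeightData W p, D.IsCanonical)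
    {P : W.toAffine.Point} (hP : W.IsAdmissible p P) :
    (W.cyclotomicPAdicHeight p).pairing P P = W.canonicalPAdicHeight p P :=
  isCanonical_cyclotomicPAdicHeight h P hP

/-- **Uniqueness**: every canonical datum IS `cyclotomicPAdicHeight W p`, provided every non-torsion
point has an admissible multiple (fact `exists_admissible_nsmul`). [Mazur–Stein–Tate 2006, §1
("extends uniquely")] [folklore] -/
theorem eq_cyclotomicPAdicHeight
    (hS : ∀ P : W.toAffine.Point, ¬ IsOfFinAddOrder P → ∃ m : ℕ, m ≠ 0 ∧ W.IsAdmissible p (m • P))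
    {D : PAdicHeightData W p} (hD : D.IsCanonical) : D = W.cyclotomicPAdicHeight p :=
  PAdicHeightData.isCanonical_unique hS hD (isCanonical_cyclotomicPAdicHeight ⟨D, hD⟩)

/-- Fed with the named fact `exists_isCanonical`: for `W` globally minimal and `p ≥ 5` of good
ordinary reduction, `cyclotomicPAdicHeight W p` is the canonical cyclotomic `p`-adic height.
[Mazur–Stein–Tate 2006, §1; Stein–Wuthrich 2013, §4.1] [folklore] -/
theorem isCanonical_cyclotomicPAdicHeight_of_fact (hex : exists_isCanonical) [W.IsElliptic]
    [W.IsGloballyMinimal] (hp : 5 ≤ p) (hgood : W.HasGoodReductionAtPrime p)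
    (hord : ¬ (p : ℤ) ∣ W.frobeniusTrace p) : (W.cyclotomicPAdicHeight p).IsCanonical :=
  isCanonical_cyclotomicPAdicHeight (hex W p hp hgood hord)

/-- Fed with the named fact `exists_admissible_nsmul`: for `W` globally minimal, any canonical
datum equals `cyclotomicPAdicHeight W p`. [Mazur–Stein–Tate 2006, §1] [folklore] -/
theorem eq_cyclotomicPAdicHeight_of_fact (hadm : exists_admissible_nsmul) [W.IsElliptic]
    [W.IsGloballyMinimal] {D : PAdicHeightData W p} (hD : D.IsCanonical) :
    D = W.cyclotomicPAdicHeight p :=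
  eq_cyclotomicPAdicHeight (hadm W p) hD

/-- **Schneider's conjecture, two phrasings.** Given existence of a canonical datum and admissible
multiples, `Reg_p ≠ 0` for THE canonical datum (`SchneiderConjecture (cyclotomicPAdicHeight W p)`,
route item stmt-0138) is equivalent to `Reg_p(D) ≠ 0` for EVERY canonical `D` (route item
stmt-0536). [Mazur–Stein–Tate 2006, Conj. 1.1; Schneider 1982, §1] [folklore] -/
theorem schneiderConjecture_cyclotomicPAdicHeight_iff (h : ∃ D : PAdicHeightData W p, D.IsCanonical)
    (hS : ∀ P : W.toAffine.Point, ¬ IsOfFinAddOrder P → ∃ m : ℕ, m ≠ 0 ∧ W.IsAdmissible p (m • P)) :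
    SchneiderConjecture (W.cyclotomicPAdicHeight p) ↔
      ∀ D : PAdicHeightData W p, D.IsCanonical → SchneiderConjecture D := by
  constructor
  · intro hc D hD
    rwa [eq_cyclotomicPAdicHeight hS hD]
  · intro H
    exact H _ (isCanonical_cyclotomicPAdicHeight h)

/-- The same equivalence with the tree's named facts as hypotheses (`W` globally minimal, `p ≥ 5`
good ordinary). [Mazur–Stein–Tate 2006, Conj. 1.1] [folklore] -/
theorem schneiderConjecture_cyclotomicPAdicHeight_iff_of_facts (hex : exists_isCanonical)
    (hadm : exists_admissible_nsmul) [W.IsElliptic] [W.IsGloballyMinimal] (hp : 5 ≤ p)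
    (hgood : W.HasGoodReductionAtPrime p) (hord : ¬ (p : ℤ) ∣ W.frobeniusTrace p) :
    SchneiderConjecture (W.cyclotomicPAdicHeight p) ↔
      ∀ D : PAdicHeightData W p, D.IsCanonical → SchneiderConjecture D :=
  schneiderConjecture_cyclotomicPAdicHeight_iff (hex W p hp hgood hord) (hadm W p)

/-! ### The canonical cyclotomic `p`-adic height datum over a number field `K` -/

section NumberField

variable (W p)
variable (K : Type) [Field K] [NumberField K]

/-- **The canonical cyclotomic `p`-adic height pairing of `E` over the number field `K`** (for `p`
totally split in `K`; un-normalised = sum over the places of `K`, Stein–Wuthrich / `-2p`·MST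
normalisation, so that it restricts to `[K:ℚ] ·` the `ℚ`-pairing), as a term of
`PAdicHeightDataK W p K`: by choice, THE datum `DK` with `DK.IsCanonical` (quadratic form on
admissible points `= ĥ_{p,K}(P) = log_p N𝔡(x) - 2 Σ_{ι : K → ℚ_p} log_p σ_p(z(ιP))`,
Balakrishnan–Çiperiani–Stein 2015 §4.1 eq. (4.1) after MST 2006) if one exists — then unique,
`eq_cyclotomicPAdicHeightK` — and `PAdicHeightDataK.zero` (JUNK) otherwise. Existence for `W`,
`W ⊗ K` globally minimal, `p ≥ 5` good ordinary and totally split in `K` is the fact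
`exists_isCanonicalK`. Application: `K` imaginary quadratic with `p` split, the height of the
Heegner point in the `p`-adic Gross–Zagier formula (Perrin-Riou 1987, §1.2).
[Balakrishnan–Çiperiani–Stein 2015, §4.1 eq. (4.1); Perrin-Riou 1987, §1.2; Mazur–Tate–Teitelbaum
1986, §II.4–5] [cite: BalakrishnanCiperianiStein2015, §4.1 eq. (4.1)] -/
def cyclotomicPAdicHeightK : PAdicHeightDataK W p K :=
  if h : ∃ DK : PAdicHeightDataK W p K, DK.IsCanonical then h.choose else PAdicHeightDataK.zero

variable {W p K}

/-- If some canonical `K`-datum exists, `cyclotomicPAdicHeightK W p K` is canonical.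
[Balakrishnan–Çiperiani–Stein 2015, §4.1] [folklore] -/
theorem isCanonical_cyclotomicPAdicHeightK (h : ∃ DK : PAdicHeightDataK W p K, DK.IsCanonical) :
    (W.cyclotomicPAdicHeightK p K).IsCanonical := by
  unfold cyclotomicPAdicHeightK
  rw [dif_pos h]
  exact h.choose_spec

/-- Junk branch over `K`. [folklore] -/
theorem cyclotomicPAdicHeightK_of_not_exists
    (h : ¬ ∃ DK : PAdicHeightDataK W p K, DK.IsCanonical) :
    W.cyclotomicPAdicHeightK p K = PAdicHeightDataK.zero := by
  unfold cyclotomicPAdicHeightK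
  rw [dif_neg h]

/-- On a `K`-admissible point, `h_{p,K}(P) = ⟨P, P⟩ = ĥ_{p,K}(P)` (given existence).
[Balakrishnan–Çiperiani–Stein 2015, §4.1 eq. (4.1)] [folklore] -/
theorem cyclotomicPAdicHeightK_height (h : ∃ DK : PAdicHeightDataK W p K, DK.IsCanonical)
    {P : (W.baseChange K).toAffine.Point} (hP : W.IsAdmissibleK p K P) :
    (W.cyclotomicPAdicHeightK p K).height P = W.canonicalPAdicHeightK p K P :=
  (isCanonical_cyclotomicPAdicHeightK h).2 P hP

/-- **Uniqueness over `K`**: every canonical `K`-datum IS `cyclotomicPAdicHeightK W p K`, given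
admissible multiples (fact `exists_admissibleK_nsmul`). [Perrin-Riou 1987, §1.2] [folklore] -/
theorem eq_cyclotomicPAdicHeightK
    (hS : ∀ P : (W.baseChange K).toAffine.Point, ¬ IsOfFinAddOrder P →
      ∃ m : ℕ, m ≠ 0 ∧ W.IsAdmissibleK p K (m • P))
    {DK : PAdicHeightDataK W p K} (hDK : DK.IsCanonical) : DK = W.cyclotomicPAdicHeightK p K :=
  PAdicHeightDataK.isCanonical_unique hS hDK (isCanonical_cyclotomicPAdicHeightK ⟨DK, hDK⟩)

/-- Fed with the fact `exists_isCanonicalK`: for `W`, `W ⊗ K` globally minimal, `p ≥ 5` good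
ordinary and totally split in `K`, `cyclotomicPAdicHeightK W p K` is canonical.
[Balakrishnan–Çiperiani–Stein 2015, §4.1] [folklore] -/
theorem isCanonical_cyclotomicPAdicHeightK_of_fact (hex : exists_isCanonicalK) [W.IsElliptic]
    [W.IsGloballyMinimal] [(W.baseChange K).IsGloballyMinimal] (hp : 5 ≤ p)
    (hgood : W.HasGoodReductionAtPrime p) (hord : ¬ (p : ℤ) ∣ W.frobeniusTrace p)
    (hsplit : Fintype.card (K →+* ℚ_[p]) = Module.finrank ℚ K) :
    (W.cyclotomicPAdicHeightK p K).IsCanonical :=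
  isCanonical_cyclotomicPAdicHeightK (hex W K p hp hgood hord hsplit)

/-- **Restriction to `E(ℚ)`**, fed with the facts: under the same hypotheses the canonical `K`-datum
restricts to `[K:ℚ] ·` the canonical `ℚ`-datum, `⟨ιP, ιQ⟩_K = [K:ℚ] ⟨P, Q⟩`.
[Perrin-Riou 1987, §1.2; Balakrishnan–Çiperiani–Stein 2015, §4.1] [folklore] -/
theorem cyclotomicPAdicHeightK_restrictsTo (hres : isCanonicalK_restrictsTo)
    (hex : exists_isCanonical) (hexK : exists_isCanonicalK) [W.IsElliptic] [W.IsGloballyMinimal]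
    [(W.baseChange K).IsGloballyMinimal] (hp : 5 ≤ p) (hgood : W.HasGoodReductionAtPrime p)
    (hord : ¬ (p : ℤ) ∣ W.frobeniusTrace p)
    (hsplit : Fintype.card (K →+* ℚ_[p]) = Module.finrank ℚ K) :
    (W.cyclotomicPAdicHeightK p K).RestrictsTo (W.cyclotomicPAdicHeight p) :=
  hres W K p hp hgood hord _ _ (isCanonical_cyclotomicPAdicHeightK_of_fact hexK hp hgood hord hsplit)
    (isCanonical_cyclotomicPAdicHeight_of_fact hex hp hgood hord)

end NumberField

end WeierstrassCurve

end
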